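import Mathlib
import Literature.NumberTheory.DiophantineGeometry.SquarefulSumsDetMethod

/-!
# Ternary quadratic forms: Gram determinants and primitive zeros on a plane

Auxiliary file (theorems only, no definitions) for the proof of **Heath-Brown's bound for primitive
zeros of a ternary quadratic form in a box** (`Literature.NumberTheory.DiophantineGeometry.
TernaryConicPointBound`, [Heathbrown2002, Cor. 2], discharged in `TernaryConicPointBoundProofs`).

For an integral symmetric `3 × 3` matrix `M` with quadratic form `q(x) = xᵀ M x` and bilinear form
`B(x, y) = xᵀ M y`:

* `TernaryConic.dot_mulVec_decomp`: the reduction of `B` along a vector `w` with `wᵢ = 1` to the binary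
  block complementary to `i`, up to terms containing entries of `M w` (used with a kernel vector
  modulo `ℓ^γ` in `TernaryConicPointBoundLocal`, and with the Taylor expansion modulo the auxiliary
  prime in `TernaryConicPointBoundAuxPrime`);
* `TernaryConic.det_sq_mul_det_eq` (**Gram determinant**): for three zeros `x₀, x₁, x₂` of `q`,
  `det(X)² · det M = 2 B(x₀,x₁) B(x₀,x₂) B(x₁,x₂)`.  This identity replaces the lattice-index bound
  of [Heathbrown1997, §2]: if the pairings are divisible by `D`, a non-zero `det X` is large;
* `TernaryConic.card_le_four_of_coplanar`: a set of primitive zeros of a non-singular `q` any three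
  of which are linearly dependent has at most `4` elements (a line meets the conic twice; the Bézout
  step of the printed proof, cf. [Heathbrown1997, Lemma 1]).  Proof by the vector identity
  `(n·n) z = σ x + τ y` for `n = x × y`, `n·z = 0`, and `q(σx + τy) = 2στ B(x,y)`, where
  `B(x, y) ≠ 0` since otherwise `q` would vanish on a plane (`det_eq_zero_of_isotropic_plane`).

Vectors are `Fin 3 → ℤ`; primitivity is used in Bézout form as in `SquarefulSumsDetMethod`, whose
`SquarefulDet.eq_or_eq_neg_of_parallel` is reused.

## References

* D. R. Heath-Brown, *The density of rational points on cubic surfaces*, Acta Arith. 79 (1997)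
  17–30, §2 [Heathbrown1997].
* D. R. Heath-Brown, *The density of rational points on curves and surfaces*, Ann. of Math. 155
  (2002) 553–595, Corollary 2 [Heathbrown2002].
-/

namespace Literature.NumberTheory.DiophantineGeometry

namespace TernaryConic

open Finset Matrix

/-! ### Reduction of the bilinear form along a vector -/

/-- Decomposition of the bilinear form `xᵀ M y` of a symmetric `3 × 3` matrix along a vector `w`
with `w i = 1`: writing `x = x̂ + xᵢ w` with `x̂ᵢ = 0`, the value is the binary bilinear form of
the `2 × 2` block complementary to `i` (indices `j₁ < j₂`) at the reduced vectors, plus terms each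
containing an entry of `M w`. [folklore] -/
theorem dot_mulVec_decomp (M : Matrix (Fin 3) (Fin 3) ℤ) (hM : M.IsSymm) (w x y : Fin 3 → ℤ)
    (i j₁ j₂ : Fin 3) (hj₁ : j₁ = ![1, 0, 0] i) (hj₂ : j₂ = ![2, 2, 1] i) (hwi : w i = 1) :
    x ⬝ᵥ M *ᵥ y =
      (M j₁ j₁ * (x j₁ - w j₁ * x i) * (y j₁ - w j₁ * y i)
        + M j₁ j₂ * ((x j₁ - w j₁ * x i) * (y j₂ - w j₂ * y i) + (y j₁ - w j₁ * y i) * (x j₂ - w j₂ * x i))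
        + M j₂ j₂ * (x j₂ - w j₂ * x i) * (y j₂ - w j₂ * y i))
      + (y i * ((x j₁ - w j₁ * x i) * (M *ᵥ w) j₁ + (x j₂ - w j₂ * x i) * (M *ᵥ w) j₂)
        + x i * ((y j₁ - w j₁ * y i) * (M *ᵥ w) j₁ + (y j₂ - w j₂ * y i) * (M *ᵥ w) j₂)
        + x i * y i * (w 0 * (M *ᵥ w) 0 + w 1 * (M *ᵥ w) 1 + w 2 * (M *ᵥ w) 2)) := by
  have h10 : M 1 0 = M 0 1 := hM.apply 0 1
  have h20 : M 2 0 = M 0 2 := hM.apply 0 2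
  have h21 : M 2 1 = M 1 2 := hM.apply 1 2
  fin_cases i
  · simp only [Fin.zero_eta, Matrix.cons_val_zero] at hwi hj₁ hj₂
    subst hj₁ hj₂
    simp [Matrix.mulVec, dotProduct, Fin.sum_univ_three, hwi, h10, h20, h21]
    ring
  · simp only [Fin.mk_one, Matrix.cons_val_one, Matrix.cons_val_zero] at hwi hj₁ hj₂
    subst hj₁ hj₂
    simp [Matrix.mulVec, dotProduct, Fin.sum_univ_three, hwi, h10, h20, h21]
    ring
  · simp only [Fin.reduceFinMk, Matrix.cons_val] at hwi hj₁ hj₂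
    subst hj₁ hj₂
    simp [Matrix.mulVec, dotProduct, Fin.sum_univ_three, hwi, h10, h20, h21]
    ring

/-! ### The Gram determinant of three zeros -/

/-- For a symmetric matrix the bilinear form `xᵀ M y` is symmetric. [folklore] -/
theorem dot_mulVec_comm (M : Matrix (Fin 3) (Fin 3) ℤ) (hM : M.IsSymm) (x y : Fin 3 → ℤ) :
    x ⬝ᵥ M *ᵥ y = y ⬝ᵥ M *ᵥ x := by
  have h10 : M 1 0 = M 0 1 := hM.apply 0 1
  have h20 : M 2 0 = M 0 2 := hM.apply 0 2
  have h21 : M 2 1 = M 1 2 := hM.apply 1 2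
  simp [Matrix.mulVec, dotProduct, Fin.sum_univ_three, h10, h20, h21]
  ring

/-- The Gram matrix `X M Xᵀ` of the rows of `X` has entries `X_r ᵀ M X_s`. [folklore] -/
theorem gram_apply (M X : Matrix (Fin 3) (Fin 3) ℤ) (r s : Fin 3) :
    (X * M * Xᵀ) r s = X r ⬝ᵥ M *ᵥ X s := by
  simp [Matrix.mul_apply, Matrix.transpose_apply, dotProduct, Matrix.mulVec, Fin.sum_univ_three]
  ring

/-- **Gram determinant of three zeros.** If the rows of `X` are zeros of the quadratic form of the
symmetric matrix `M`, then `det(X)² · det M = 2 · B₀₁ B₀₂ B₁₂` with `B_rs = X_rᵀ M X_s`.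
[folklore] -/
theorem det_sq_mul_det_eq (M : Matrix (Fin 3) (Fin 3) ℤ) (hM : M.IsSymm) (X : Matrix (Fin 3) (Fin 3) ℤ)
    (hq : ∀ r, X r ⬝ᵥ M *ᵥ X r = 0) :
    X.det ^ 2 * M.det =
      2 * (X 0 ⬝ᵥ M *ᵥ X 1) * (X 0 ⬝ᵥ M *ᵥ X 2) * (X 1 ⬝ᵥ M *ᵥ X 2) := by
  have h1 : X.det ^ 2 * M.det = (X * M * Xᵀ).det := by
    rw [Matrix.det_mul, Matrix.det_mul, Matrix.det_transpose]; ring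
  rw [h1, Matrix.det_fin_three]
  simp only [gram_apply, hq, dot_mulVec_comm M hM (X 1) (X 0), dot_mulVec_comm M hM (X 2) (X 0),
    dot_mulVec_comm M hM (X 2) (X 1)]
  ring

/-! ### Primitive zeros on a plane: at most four -/

/-- Expansion of the determinant of three vectors along the third one. [folklore] -/
theorem det_three_eq (x y z : Fin 3 → ℤ) :
    (Matrix.of ![x, y, z]).det =
      (x 1 * y 2 - x 2 * y 1) * z 0 + (x 2 * y 0 - x 0 * y 2) * z 1 + (x 0 * y 1 - x 1 * y 0) * z 2 := by
  rw [Matrix.det_fin_three]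
  simp
  ring

/-- A quadratic form vanishing at `x`, `y` and on the pairing `xᵀ M y`, with `x, y` independent, has
`det M = 0`. [folklore] -/
theorem det_eq_zero_of_isotropic_plane (M : Matrix (Fin 3) (Fin 3) ℤ) (hM : M.IsSymm)
    (x y : Fin 3 → ℤ) (hx : x ⬝ᵥ M *ᵥ x = 0) (hy : y ⬝ᵥ M *ᵥ y = 0) (hxy : x ⬝ᵥ M *ᵥ y = 0)
    (k : Fin 3) (hk : (![x 1 * y 2 - x 2 * y 1, x 2 * y 0 - x 0 * y 2, x 0 * y 1 - x 1 * y 0] :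
      Fin 3 → ℤ) k ≠ 0) :
    M.det = 0 := by
  set X : Matrix (Fin 3) (Fin 3) ℤ := Matrix.of ![x, y, Pi.single k 1] with hX
  have hXdet : X.det ≠ 0 := by
    have : X.det = (![x 1 * y 2 - x 2 * y 1, x 2 * y 0 - x 0 * y 2, x 0 * y 1 - x 1 * y 0] :
        Fin 3 → ℤ) k := by
      rw [hX, det_three_eq]
      fin_cases k <;> simp
    rwa [this]
  have h1 : X.det ^ 2 * M.det = (X * M * Xᵀ).det := by
    rw [Matrix.det_mul, Matrix.det_mul, Matrix.det_transpose]; ring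
  have h2 : (X * M * Xᵀ).det = 0 := by
    rw [Matrix.det_fin_three]
    simp only [gram_apply]
    have hX0 : X 0 = x := rfl
    have hX1 : X 1 = y := rfl
    rw [hX0, hX1, hx, hy, hxy, dot_mulVec_comm M hM y x, hxy]
    ring
  rw [h2] at h1
  rcases mul_eq_zero.mp h1 with h3 | h3
  · exact absurd (pow_eq_zero_iff two_ne_zero |>.mp h3) hXdet
  · exact h3

/-- **At most four primitive zeros on a plane section.** A set of primitive integer zeros of a
non-singular ternary quadratic form, any three of which are linearly dependent, has at most `4`
elements: a line meets the conic in at most two points. [folklore] -/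
theorem card_le_four_of_coplanar (M : Matrix (Fin 3) (Fin 3) ℤ) (hM : M.IsSymm) (hdet : M.det ≠ 0)
    (T : Finset (Fin 3 → ℤ))
    (hprim : ∀ z ∈ T, ∃ b : Fin 3 → ℤ, ∑ i, b i * z i = 1)
    (hzero : ∀ z ∈ T, z ⬝ᵥ M *ᵥ z = 0)
    (hcop : ∀ x ∈ T, ∀ y ∈ T, ∀ z ∈ T, (Matrix.of ![x, y, z]).det = 0) :
    #T ≤ 4 := by
  classical
  rcases T.eq_empty_or_nonempty with rfl | ⟨x, hx⟩
  · simp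
  by_cases hpar : ∀ z ∈ T, x 0 * z 1 = x 1 * z 0 ∧ x 0 * z 2 = x 2 * z 0 ∧ x 1 * z 2 = x 2 * z 1
  · -- everything is parallel to `x`
    have hsub : T ⊆ {x, -x} := by
      intro z hz
      obtain ⟨h01, h02, h12⟩ := hpar z hz
      rcases SquarefulDet.eq_or_eq_neg_of_parallel (hprim x hx) (hprim z hz) h01 h02 h12 with h | h
      · rw [h]; simp
      · rw [h]; simp
    exact (Finset.card_le_card hsub).trans ((Finset.card_insert_le _ _).trans (by simp))
  · push Not at hpar
    obtain ⟨y, hy, hny⟩ := hpar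
    -- the normal vector `n = x × y` is non-zero
    set n : Fin 3 → ℤ := ![x 1 * y 2 - x 2 * y 1, x 2 * y 0 - x 0 * y 2, x 0 * y 1 - x 1 * y 0] with hn
    have hn0 : ∃ k, n k ≠ 0 := by
      by_contra hall
      push Not at hall
      have e0 := hall 0; have e1 := hall 1; have e2 := hall 2
      simp only [hn, Matrix.cons_val_zero, Matrix.cons_val_one, Matrix.cons_val] at e0 e1 e2
      exact hny (by linarith) (by linarith) (by linarith)
    obtain ⟨k, hk⟩ := hn0
    have hBxy : x ⬝ᵥ M *ᵥ y ≠ 0 := fun h0 =>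
      hdet (det_eq_zero_of_isotropic_plane M hM x y (hzero x hx) (hzero y hy) h0 k hk)
    set N : ℤ := n 0 ^ 2 + n 1 ^ 2 + n 2 ^ 2 with hN
    have hN0 : N ≠ 0 := by
      intro h0
      rw [hN] at h0
      have hsq : n 0 ^ 2 = 0 ∧ n 1 ^ 2 = 0 ∧ n 2 ^ 2 = 0 := by
        refine ⟨?_, ?_, ?_⟩ <;> nlinarith [sq_nonneg (n 0), sq_nonneg (n 1), sq_nonneg (n 2)]
      have h0' : n 0 = 0 := pow_eq_zero_iff two_ne_zero |>.mp hsq.1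
      have h1' : n 1 = 0 := pow_eq_zero_iff two_ne_zero |>.mp hsq.2.1
      have h2' : n 2 = 0 := pow_eq_zero_iff two_ne_zero |>.mp hsq.2.2
      fin_cases k
      · exact hk h0'
      · exact hk h1'
      · exact hk h2'
    have hsub : T ⊆ {x, -x, y, -y} := by
      intro z hz
      have hnz : n 0 * z 0 + n 1 * z 1 + n 2 * z 2 = 0 := by
        have := hcop x hx y hy z hz
        rw [det_three_eq] at this
        simp only [hn, Matrix.cons_val_zero, Matrix.cons_val_one, Matrix.cons_val]
        linarith
      -- `N z = σ x + τ y`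
      set σ : ℤ := (z 0 * x 0 + z 1 * x 1 + z 2 * x 2) * (y 0 * y 0 + y 1 * y 1 + y 2 * y 2)
        - (z 0 * y 0 + z 1 * y 1 + z 2 * y 2) * (x 0 * y 0 + x 1 * y 1 + x 2 * y 2) with hσ
      set τ : ℤ := (z 0 * y 0 + z 1 * y 1 + z 2 * y 2) * (x 0 * x 0 + x 1 * x 1 + x 2 * x 2)
        - (z 0 * x 0 + z 1 * x 1 + z 2 * x 2) * (x 0 * y 0 + x 1 * y 1 + x 2 * y 2) with hτ
      have hdec : ∀ j, N * z j = σ * x j + τ * y j := by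
        intro j
        simp only [hN, hσ, hτ, hn, Matrix.cons_val_zero, Matrix.cons_val_one, Matrix.cons_val] at hnz ⊢
        fin_cases j
        · simp only [Fin.zero_eta]
          linear_combination (x 1 * y 2 - x 2 * y 1) * hnz
        · simp only [Fin.mk_one]
          linear_combination (x 2 * y 0 - x 0 * y 2) * hnz
        · simp only [Fin.reduceFinMk]
          linear_combination (x 0 * y 1 - x 1 * y 0) * hnz
      -- evaluate the form
      have h10 : M 1 0 = M 0 1 := hM.apply 0 1
      have h20 : M 2 0 = M 0 2 := hM.apply 0 2
      have h21 : M 2 1 = M 1 2 := hM.apply 1 2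
      have hq : σ * τ * (x ⬝ᵥ M *ᵥ y) = 0 := by
        have hz0 := hzero z hz
        have hx0 := hzero x hx
        have hy0 := hzero y hy
        have e0 := hdec 0; have e1 := hdec 1; have e2 := hdec 2
        simp only [Matrix.mulVec, dotProduct, Fin.sum_univ_three, h10, h20, h21] at hz0 hx0 hy0 ⊢
        have key : (σ * x 0 + τ * y 0) * (M 0 0 * (σ * x 0 + τ * y 0) + M 0 1 * (σ * x 1 + τ * y 1)
              + M 0 2 * (σ * x 2 + τ * y 2))
            + (σ * x 1 + τ * y 1) * (M 0 1 * (σ * x 0 + τ * y 0) + M 1 1 * (σ * x 1 + τ * y 1)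
              + M 1 2 * (σ * x 2 + τ * y 2))
            + (σ * x 2 + τ * y 2) * (M 0 2 * (σ * x 0 + τ * y 0) + M 1 2 * (σ * x 1 + τ * y 1)
              + M 2 2 * (σ * x 2 + τ * y 2)) =
            N ^ 2 * (z 0 * (M 0 0 * z 0 + M 0 1 * z 1 + M 0 2 * z 2) +
              z 1 * (M 0 1 * z 0 + M 1 1 * z 1 + M 1 2 * z 2) +
              z 2 * (M 0 2 * z 0 + M 1 2 * z 1 + M 2 2 * z 2)) := by
          rw [← e0, ← e1, ← e2]; ring
        have key2 : (σ * x 0 + τ * y 0) * (M 0 0 * (σ * x 0 + τ * y 0) + M 0 1 * (σ * x 1 + τ * y 1)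
              + M 0 2 * (σ * x 2 + τ * y 2))
            + (σ * x 1 + τ * y 1) * (M 0 1 * (σ * x 0 + τ * y 0) + M 1 1 * (σ * x 1 + τ * y 1)
              + M 1 2 * (σ * x 2 + τ * y 2))
            + (σ * x 2 + τ * y 2) * (M 0 2 * (σ * x 0 + τ * y 0) + M 1 2 * (σ * x 1 + τ * y 1)
              + M 2 2 * (σ * x 2 + τ * y 2)) =
            σ ^ 2 * (x 0 * (M 0 0 * x 0 + M 0 1 * x 1 + M 0 2 * x 2) +
              x 1 * (M 0 1 * x 0 + M 1 1 * x 1 + M 1 2 * x 2) +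
              x 2 * (M 0 2 * x 0 + M 1 2 * x 1 + M 2 2 * x 2)) +
            τ ^ 2 * (y 0 * (M 0 0 * y 0 + M 0 1 * y 1 + M 0 2 * y 2) +
              y 1 * (M 0 1 * y 0 + M 1 1 * y 1 + M 1 2 * y 2) +
              y 2 * (M 0 2 * y 0 + M 1 2 * y 1 + M 2 2 * y 2)) +
            2 * (σ * τ * (x 0 * (M 0 0 * y 0 + M 0 1 * y 1 + M 0 2 * y 2) +
              x 1 * (M 0 1 * y 0 + M 1 1 * y 1 + M 1 2 * y 2) +
              x 2 * (M 0 2 * y 0 + M 1 2 * y 1 + M 2 2 * y 2))) := by ring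
        have h2q : 2 * (σ * τ * (x 0 * (M 0 0 * y 0 + M 0 1 * y 1 + M 0 2 * y 2) +
              x 1 * (M 0 1 * y 0 + M 1 1 * y 1 + M 1 2 * y 2) +
              x 2 * (M 0 2 * y 0 + M 1 2 * y 1 + M 2 2 * y 2))) = 0 := by
          linear_combination key - key2 + N ^ 2 * hz0 - σ ^ 2 * hx0 - τ ^ 2 * hy0
        rcases mul_eq_zero.mp h2q with h | h
        · exact absurd h two_ne_zero
        · exact h
      have hst : σ = 0 ∨ τ = 0 := by
        rcases mul_eq_zero.mp hq with h | h
        · exact mul_eq_zero.mp h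
        · exact absurd h hBxy
      simp only [Finset.mem_insert, Finset.mem_singleton]
      rcases hst with hs | ht
      · -- `N z = τ y`: `z` is parallel to `y`
        have e : ∀ j, N * z j = τ * y j := fun j => by rw [hdec j, hs]; ring
        have hpy : y 0 * z 1 = y 1 * z 0 ∧ y 0 * z 2 = y 2 * z 0 ∧ y 1 * z 2 = y 2 * z 1 := by
          refine ⟨?_, ?_, ?_⟩
          · have : N * (y 0 * z 1 - y 1 * z 0) = 0 := by linear_combination y 0 * e 1 - y 1 * e 0
            rcases mul_eq_zero.mp this with h | h
            · exact absurd h hN0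
            · linarith
          · have : N * (y 0 * z 2 - y 2 * z 0) = 0 := by linear_combination y 0 * e 2 - y 2 * e 0
            rcases mul_eq_zero.mp this with h | h
            · exact absurd h hN0
            · linarith
          · have : N * (y 1 * z 2 - y 2 * z 1) = 0 := by linear_combination y 1 * e 2 - y 2 * e 1
            rcases mul_eq_zero.mp this with h | h
            · exact absurd h hN0
            · linarith
        rcases SquarefulDet.eq_or_eq_neg_of_parallel (hprim y hy) (hprim z hz) hpy.1 hpy.2.1 hpy.2.2
          with h | h
        · exact Or.inr (Or.inr (Or.inl h))
        · exact Or.inr (Or.inr (Or.inr h))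
      · -- `N z = σ x`: `z` is parallel to `x`
        have e : ∀ j, N * z j = σ * x j := fun j => by rw [hdec j, ht]; ring
        have hpx : x 0 * z 1 = x 1 * z 0 ∧ x 0 * z 2 = x 2 * z 0 ∧ x 1 * z 2 = x 2 * z 1 := by
          refine ⟨?_, ?_, ?_⟩
          · have : N * (x 0 * z 1 - x 1 * z 0) = 0 := by linear_combination x 0 * e 1 - x 1 * e 0
            rcases mul_eq_zero.mp this with h | h
            · exact absurd h hN0
            · linarith
          · have : N * (x 0 * z 2 - x 2 * z 0) = 0 := by linear_combination x 0 * e 2 - x 2 * e 0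
            rcases mul_eq_zero.mp this with h | h
            · exact absurd h hN0
            · linarith
          · have : N * (x 1 * z 2 - x 2 * z 1) = 0 := by linear_combination x 1 * e 2 - x 2 * e 1
            rcases mul_eq_zero.mp this with h | h
            · exact absurd h hN0
            · linarith
        rcases SquarefulDet.eq_or_eq_neg_of_parallel (hprim x hx) (hprim z hz) hpx.1 hpx.2.1 hpx.2.2
          with h | h
        · exact Or.inl h
        · exact Or.inr (Or.inl h)
    calc #T ≤ #({x, -x, y, -y} : Finset (Fin 3 → ℤ)) := Finset.card_le_card hsub
      _ ≤ 4 := by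
        refine (Finset.card_insert_le _ _).trans ?_
        refine Nat.succ_le_succ ((Finset.card_insert_le _ _).trans ?_)
        refine Nat.succ_le_succ ((Finset.card_insert_le _ _).trans ?_)
        simp

end TernaryConic

end Literature.NumberTheory.DiophantineGeometry
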